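import Summits.BirchSwinnertonDyer.BirchSwinnertonDyer.Theses.SignedLowerHalves
import Summits.BirchSwinnertonDyer.BirchSwinnertonDyer.Theorems.ThetaPartnerAtTwoSignedMainConjectureCMTwoRankZeroPollackPairUnique
import Summits.BirchSwinnertonDyer.BirchSwinnertonDyer.Theorems.ResidualThetaTransportAtTwoThetaLayerLambdaCongruenceAtTwoLayerAlgebra
import Summits.BirchSwinnertonDyer.BirchSwinnertonDyer.Theorems.ResidualThetaTransportAtTwoThetaLayerLambdaCongruenceAtTwoReduction
import HarnessLib

/-!
# Disproof of `SmallImageLowerHalfBothSigns` (crux L · stmt-BirchSwinnertonDyer-23599) — standing disprover, gen 0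

Work file of the refuter seat `cdisprove-stmt-BirchSwinnertonDyer-23599` (CRUX PROTOCOL — DISPROVER). Prose lives in
docstrings; every `theorem` below is kernel-checked (no `sorry`). Line of record attacked: `Lines/rtt_w3.lean` v2
(sha16 `b8b0010d8543aede`, 7 stubs, namespace `…Cruxes.SmallImageLowerHalfBothSigns.Rtt`).

**VERDICT (2026-08-29, gen 0, sessions 1–4): NO KILL.** The crux as typed is a faithful instance of the Eisenstein (lower) half of
Kobayashi's signed main conjecture, both signs, on the small-image X7 class; every junk path through its binders is
closed by landed uniqueness / invariance facts (§2); its five outer guards are ROUTING guards, not truth-load-bearing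
(§1: no `_false_without_` theorem is available for any of them, and one — `a_p = 0` — is provably redundant for
`p ≥ 5`); no counterexample family of the area applies (CM: Pollack–Rubin is a theorem; semistable: BSTW's domain).

## Findings index
* §1 `Without…` — the crux with one guard dropped, the trivial implications `Without… → crux`, and
  `withoutApZeroOfFiveLe_of_crux` / `crux_iff_withoutApZeroOfFiveLe_and_atThree` (kernel: the guard `a_p = 0` is
  decoration at `p ≥ 5`, by `ClassX7.frobeniusTrace_eq_zero_of_five_le`).
* §2 junk paths closed, as citations: `isPollackPair_unique` (the `∀ Lplus Lminus` binder is a singleton),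
  `layerLambda_C_mul` (the `Ω`/`ϖ`/`p^m` scalings in Kan₂/Kλ₂ cannot move a λ), `layerLambda_mul_modByMonic`
  (the depleted-λ identity of Kan₂ IS «λ_n(θ_W) + Σ_{v∈S₀} λ(P_v^W) = λ_n(θ_g) + Σ_{v∈S₀} λ(P_v^g)» inside the
  headroom), parity bookkeeping `even_iff_eq_one_iff` / `kobayashiL_neg_one'` (ε = −1 ↔ odd n ↔ `L⁺`, consistent with
  Pollack Prop. 6.18 / Kobayashi (3.6)).
* §3 `-- Targets`: per-stub findings for the 7 v2 stubs (which hypotheses are load-bearing, which look redundant).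
* §4 numerics: PREREG `pub/bsd-ssimc/cdisprove-stmt-BirchSwinnertonDyer-23599/PREREG-cdisprove-23599-gvkan2.md`
  (sha16 4370d5023df2776b; caps line amended 839c353487edc3e8), kit job `j335262` DONE (rc 0, 1.9 core-h): Q1 Kan₂ identity
  `D_an = D_loc` PASS 158/158 (79 CM-curve-partnered pairs × 2 parities), Q2 unit content UNIT-BOTH 93/93 (all 36 `p ≥ 5`
  small-image pairs included), 0 engine disagreements on 301 two-engine layers, three engines agree on 25/25 PARI partners;
  paper pre-check 21/21. RESULT memo `…/gvkan2/RESULT-gvkan2.md` (sha16 a6b3273b22224da1).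
* T1 census (LEAD's `disprover-wanted`): 79/136 open pairs have a CM ELLIPTIC-CURVE partner (k3-c4 records, not re-run) —
  `…/T1-CENSUS.md` (sha16 18ce54dbb8ac7014).
* §5 HANDOFF.

HONEST FRAMING: nothing here proves BSD for any curve; §4 is a numerical instrument whose letters concern a
numerical identity between Mazur–Tate layers only.
-/

-- the Cruxes namespace of this sub repeats the summit name by design (D-0017 nested layout)
set_option linter.dupNamespace false

open scoped Classical MatrixGroups ModularForm
open CongruenceSubgroup WeierstrassCurve Literature.NumberTheory.EllipticCurves
open Literature.NumberTheory.EllipticCurves.Rank1Residual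
open Summit.BirchSwinnertonDyer.Rank1Residual.Supersingular
open Summit.BirchSwinnertonDyer.BirchSwinnertonDyer.Theses.SignedLowerHalves (SmallImageLowerHalfBothSigns)

namespace Summit.BirchSwinnertonDyer.BirchSwinnertonDyer.Cruxes.SmallImageLowerHalfBothSigns.Disproof

/-! ## §1. Load-bearing analysis of the five outer guards -/

/-- Crux L with the guard `¬ W.HasCM` DROPPED. **Not refutable here:** the added instances are the CM curves with
good supersingular reduction at an odd `p` (automatically non-semistable and non-surjective), where the lower half of
the signed main conjecture is the Pollack–Rubin theorem (Ann. of Math. 159 (2004), Thm. 1.1) — true in print, not yet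
a tree theorem at odd `p` for this typed shape. So `¬CM` is a ROUTING guard (the CM case is another line's business),
not truth-load-bearing: no `_false_without_notCM`. [cite: Kobayashi2003, Thm. 1.3 (p. 3)] -/
def WithoutNotCM : Prop :=
  ∀ (W : WeierstrassCurve ℚ) [W.IsElliptic] [W.IsGloballyMinimal] (p : ℕ) [Fact p.Prime], p ≠ 2 → ClassX7 W p →
    W.frobeniusTrace p = 0 → ¬ Surj W p → ∀ ε : ℤˣ, KobayashiLowerDivisibility W p ε

/-- Crux L with the guard `¬ Surj W p` DROPPED (= lower half on ALL of class X7 with `a_p = 0`, both signs).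
**Not refutable here:** the added (surjective-image) instances are crux 3's domain
(`KobayashiLowerHalfLargeImage…`), conjecturally true and partly in print (BSTW24 at square-free-away-from-p level
does not cover X7, but no counterexample is known or expected). ROUTING guard; no `_false_without_notSurj`. -/
def WithoutNotSurj : Prop :=
  ∀ (W : WeierstrassCurve ℚ) [W.IsElliptic] [W.IsGloballyMinimal] (p : ℕ) [Fact p.Prime], p ≠ 2 → ClassX7 W p →
    ¬ W.HasCM → W.frobeniusTrace p = 0 → ∀ ε : ℤˣ, KobayashiLowerDivisibility W p ε

/-- Crux L with `ClassX7 W p = GoodSS W p ∧ ¬Semistable W` WEAKENED to `GoodSS W p` (semistable curves allowed =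
X6 ∪ X7). **Not refutable here:** the added semistable supersingular non-surjective instances are EMPTY for `p ≥ 7`
(Serre/Mazur: semistable ⇒ `ρ̄_{E,p}` surjective for `p ≥ 7`… and for `p = 3, 5` the exceptions are isogeny cases,
excluded by supersingularity only partially) and in any case lie in BSTW's announced domain (X6). ROUTING guard. -/
def WithoutNonSemistable : Prop :=
  ∀ (W : WeierstrassCurve ℚ) [W.IsElliptic] [W.IsGloballyMinimal] (p : ℕ) [Fact p.Prime], p ≠ 2 → GoodSS W p →
    ¬ W.HasCM → W.frobeniusTrace p = 0 → ¬ Surj W p → ∀ ε : ℤˣ, KobayashiLowerDivisibility W p ε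

/-- Crux L with the guard `p ≠ 2` DROPPED. **Not refutable here:** at `p = 2` with `a_2 = 0` the binder
`IsPollackPair f 2 Lplus Lminus` is Pollack's construction at `2` (the route's `…AtTwo…` files treat it); the
added instances are the `p = 2` small-image pairs, where the statement is the cell bsd-wall's business and no
counterexample is known; if no Pollack pair exists the inner statement is vacuously true. ROUTING guard. -/
def WithoutPNeTwo : Prop :=
  ∀ (W : WeierstrassCurve ℚ) [W.IsElliptic] [W.IsGloballyMinimal] (p : ℕ) [Fact p.Prime], ClassX7 W p →
    ¬ W.HasCM → W.frobeniusTrace p = 0 → ¬ Surj W p → ∀ ε : ℤˣ, KobayashiLowerDivisibility W p ε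

/-- Crux L with the guard `a_p = 0` DROPPED. For `p ≥ 5` this changes NOTHING (`ClassX7 ⇒ p ∣ a_p ⇒ a_p = 0` by
Hasse: `withoutApZeroOfFiveLe_of_crux`); at `p = 3` it adds the `a_3 = ±3` pairs (class X8, Sprung's ♯/♭ theory), where
Pollack's `±` pair is not the right object (the inner statement is then about whatever satisfies `IsPollackPair f 3`,
plausibly nothing ⇒ vacuous). **Not refutable here**; REDUNDANT at `p ≥ 5` (kernel, below). -/
def WithoutApZero : Prop :=
  ∀ (W : WeierstrassCurve ℚ) [W.IsElliptic] [W.IsGloballyMinimal] (p : ℕ) [Fact p.Prime], p ≠ 2 → ClassX7 W p →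
    ¬ W.HasCM → ¬ Surj W p → ∀ ε : ℤˣ, KobayashiLowerDivisibility W p ε

/-- The `p ≥ 5` part of crux L with the guard `a_p = 0` dropped. -/
def WithoutApZeroOfFiveLe : Prop :=
  ∀ (W : WeierstrassCurve ℚ) [W.IsElliptic] [W.IsGloballyMinimal] (p : ℕ) [Fact p.Prime], 5 ≤ p → ClassX7 W p →
    ¬ W.HasCM → ¬ Surj W p → ∀ ε : ℤˣ, KobayashiLowerDivisibility W p ε

/-- The `p = 3` part of crux L (guard `a_3 = 0` kept: it excludes class X8). -/
def AtThree : Prop :=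
  ∀ (W : WeierstrassCurve ℚ) [W.IsElliptic] [W.IsGloballyMinimal] [Fact (3 : ℕ).Prime], ClassX7 W 3 →
    ¬ W.HasCM → W.frobeniusTrace 3 = 0 → ¬ Surj W 3 → ∀ ε : ℤˣ, KobayashiLowerDivisibility W 3 ε

/-- Guard lattice: each single-guard weakening implies the crux (trivially). [father: implication] -/
theorem of_withoutNotCM (h : WithoutNotCM) : SmallImageLowerHalfBothSigns :=
  fun W _ _ p _ hp hX _ hap hS ε => h W p hp hX hap hS ε

/-- [father: implication] -/
theorem of_withoutNotSurj (h : WithoutNotSurj) : SmallImageLowerHalfBothSigns :=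
  fun W _ _ p _ hp hX hCM hap _ ε => h W p hp hX hCM hap ε

/-- [father: implication] -/
theorem of_withoutNonSemistable (h : WithoutNonSemistable) : SmallImageLowerHalfBothSigns :=
  fun W _ _ p _ hp hX hCM hap hS ε => h W p hp hX.1 hCM hap hS ε

/-- [father: implication] -/
theorem of_withoutPNeTwo (h : WithoutPNeTwo) : SmallImageLowerHalfBothSigns :=
  fun W _ _ p _ _ hX hCM hap hS ε => h W p hX hCM hap hS ε

/-- [father: implication] -/
theorem of_withoutApZero (h : WithoutApZero) : SmallImageLowerHalfBothSigns :=
  fun W _ _ p _ hp hX hCM _ hS ε => h W p hp hX hCM hS ε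

/-- **The guard `a_p = 0` is decoration at `p ≥ 5`** (hypothesis-mutation finding, kernel-exact): crux L already
gives the `p ≥ 5` statement with that guard dropped, because on class X7 `p ∣ a_p` and Hasse force `a_p = 0`
(`ClassX7.frobeniusTrace_eq_zero_of_five_le`). [father: ClassX7.frobeniusTrace_eq_zero_of_five_le] -/
theorem withoutApZeroOfFiveLe_of_crux (h : SmallImageLowerHalfBothSigns) : WithoutApZeroOfFiveLe := by
  intro W _ _ p _ hp5 hX hCM hS ε
  have hp2 : p ≠ 2 := by omega
  exact h W p hp2 hX hCM (ClassX7.frobeniusTrace_eq_zero_of_five_le W p hp5 hX) hS ε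

/-- Crux L splits as «`p ≥ 5` without the `a_p = 0` guard» ∧ «`p = 3` with it» — the only odd primes below `5`
being `3`. [father: withoutApZeroOfFiveLe_of_crux] -/
theorem crux_iff_withoutApZeroOfFiveLe_and_atThree :
    SmallImageLowerHalfBothSigns ↔ (WithoutApZeroOfFiveLe ∧ AtThree) := by
  constructor
  · intro h
    exact ⟨withoutApZeroOfFiveLe_of_crux h, fun W _ _ _ hX hCM hap hS ε => h W 3 (by decide) hX hCM hap hS ε⟩
  · rintro ⟨h5, h3⟩ W _ _ p hpr hp2 hX hCM hap hS ε
    by_cases hp5 : 5 ≤ p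
    · exact h5 W p hp5 hX hCM hS ε
    · have h2 := hpr.out.two_le
      have hlt : p < 5 := by omega
      interval_cases p
      · exact absurd rfl hp2
      · exact h3 W hX hCM hap hS ε
      · exact absurd hpr.out (by decide)

/-! ## §2. Junk paths through the inner binders — closed (citations of landed kernel facts) -/

/-- The binder `∀ Lplus Lminus, IsPollackPair f p Lplus Lminus → …` ranges over AT MOST ONE pair: no junk Pollack
pair can be fed to the crux. [father: Theorems.isPollackPair_unique] -/
theorem pollackPair_subsingleton {N : ℕ} [NeZero N] {f : CuspForm (Gamma0 N) 2} {p : ℕ} [Fact p.Prime]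
    {Lplus Lminus Lplus' Lminus' : IwasawaAlgebra p}
    (h : IsPollackPair f p Lplus Lminus) (h' : IsPollackPair f p Lplus' Lminus') (ε : ℤˣ) :
    kobayashiL ε Lplus Lminus = kobayashiL ε Lplus' Lminus' := by
  obtain ⟨rfl, rfl⟩ := Theorems.isPollackPair_unique h h'
  rfl

/-- Parity bookkeeping of Kan₂/Kλ₂'s clause `(Even n ↔ ε = 1)` at the sign `ε = −1`: it selects exactly the ODD
layers — Pollack's `ω_n^+`-congruences, i.e. the tree's `L⁺` = `kobayashiL (-1)` (next lemma). Consistent with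
`IsCongrModOmega` (odd `n` ↔ `ω_n^+ L⁺`) and Kobayashi (3.6); no sign-label kill. [folklore] -/
theorem even_iff_eq_one_iff_odd (n : ℕ) : (Even n ↔ (-1 : ℤˣ) = 1) ↔ Odd n := by
  have h : (-1 : ℤˣ) ≠ 1 := by decide
  simp only [h, iff_false, Nat.not_even_iff_odd]

/-- … and at `ε = 1` it selects the EVEN layers (`ω_n^-`-congruences, the tree's `L⁻` = `kobayashiL 1`). [folklore] -/
theorem even_iff_eq_one_iff_even (n : ℕ) : (Even n ↔ (1 : ℤˣ) = 1) ↔ Even n := by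
  simp only [iff_true]

/-- `kobayashiL (-1) = L⁺` (odd layers) — companion of the landed `kobayashiL_one`. [folklore] -/
theorem kobayashiL_neg_one' {p : ℕ} [Fact p.Prime] (Lplus Lminus : IwasawaAlgebra p) :
    kobayashiL (-1) Lplus Lminus = Lplus := by
  have h : (-1 : ℤˣ) ≠ 1 := by decide
  simp [kobayashiL, h]

section Layer
open Polynomial Literature.NumberTheory.IwasawaTheory
open Summit.BirchSwinnertonDyer.BirchSwinnertonDyer.Theorems.ThetaLayerLambdaCongruenceAtTwo

variable {K : Type*} [NormedField K] [IsUltrametricDist K]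

/-- **No Ω-junk in Kan₂/Kλ₂.** `IsPlusPeriod g Ω` fixes `Ω` only up to `coeffField g`-multiples, `ϖ` and `p^m`
rescale `G`; none of these can move a layer-λ: `layerLambda (C c * θ) = layerLambda θ` for `c ≠ 0` (landed
`layerLambda_C_mul`). Hence the weaker `IsPlusPeriod` (not `IsCohomologicalPlusPeriod`) in Kan₂ is harmless FOR λ
(it would not be for μ / unit content — Kan₂ does not claim those). [father: ThetaLayerLambdaCongruenceAtTwo.layerLambda_C_mul] -/
theorem layerLambda_rescale {c : K} (hc : c ≠ 0) (θ : K[X]) : layerLambda (C c * θ) = layerLambda θ :=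
  layerLambda_C_mul hc θ

/-- **What Kan₂'s depleted-λ equality unfolds to** (the identity tested numerically in §4): inside the headroom
`λθ + λP < deg ω`, `λ((θ·P) %ₘ ω) = λθ + λP` (landed layer product rule), so
`λ_n(θ_W·E^W_{S₀}) = λ_n(θ_g·E^g_{S₀})` ⟺ `λ_n(θ_W) − λ_n(θ_g) = Σ_{v∈S₀} (λ(E^g_v) − λ(E^W_v))` =: `D_loc`.
[father: ThetaLayerLambdaCongruenceAtTwo.layerLambda_mul_modByMonic] -/
theorem layerLambda_depleted {ω : K[X]} (hω : ω.Monic) (hω1 : ω.supNorm ≤ 1)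
    (hlt : (ω - X ^ ω.natDegree).supNorm < 1) {θ P : K[X]} (hθ : θ ≠ 0) (hP : P ≠ 0)
    (hlam : layerLambda θ + layerLambda P < ω.natDegree) :
    layerLambda ((θ * P) %ₘ ω) = layerLambda θ + layerLambda P :=
  (layerLambda_mul_modByMonic hω hω1 hlt hθ hP hlam).1

end Layer

/-! ## §3. Targets — the 7 stubs of `Lines/rtt_w3.lean` v2 (findings; no stub is broken)

-- Targets (lead's HELPER-TABLE 3e055652ce9bb9d0; none STUCK-listed to me yet)

* **T1 `stub_publishedInputs_rtt`** (cite-conjunction: Kobayashi Thm 6.2/6.3/7.3 signed Coleman–Kato ∧ Thm 1.2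
  torsion ∧ Thm 4.1 divisibility ∧ period-unit facts). Not attackable by models; the period-unit conjuncts
  (`realPeriodRat_eq_unit_mul_plusPeriod[_three]`) are the only place where a normalisation could bite — they are
  stated for the route's `plusPeriod f` (cohomological), consistent with `IsNewformOf`/Manin-constant facts. No finding.
* **T2 `stub_muOneSign_ns_ge5`** (= retired 23117: ∃ sign with unit content, `p ≥ 5`). A finite layer table can
  certify `μ(ϑ_n) = 0` per pair/sign (Q2 of §4: all 36 `p ≥ 5` small-image pairs, 14 never tabulated) but can never
  certify `μ ≥ 1` ⇒ NO kill letter obtainable from numerics; theory-side the statement is Pollack's Conj./Greenberg–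
  Iovita–Pollack heuristics — no counterexample family known at non-split-Cartan image. The `5 ≤ p` guard: at
  `p = 3` the k3-c4 «μ-binder» pairs (partner `A : y² = x³ + kx`, `3 ∣ #A(ℚ)_tors·Tam`) are where one-sign unit
  content is delicate; the line routes `p = 3` through Kλ₂ instead — consistent.
* **T3 `stub_heckeThetaPartner_ns`** — PROVED by the width seat (kernel, modulo farm verify p733453). Nothing to attack.
* **T4 `stub_levelInputs_rtt`** (Hida Thm 3.26 Galois rep ∧ Carayol ∧ Swan = wild exponent): print facts. No finding.
* **T5 `stub_levelMatch_ns`** (`∀ ℓ ≠ p, max 2 (v_ℓ M) = max 2 (v_ℓ N_W)`). Analysis: for `ℓ ≠ p`, wild inertia at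
  `ℓ` is pro-ℓ, and reduction mod `p` is injective on a finite ℓ-group ⇒ Swan conductors of `ρ_g,ℓ` and `ρ_W,ℓ` agree
  as soon as `ρ̄_g ≅ ρ̄_W` (which the congruence clause + irreducibility of `ρ̄_W = Ind ψ̄` give); Swan > 0 forces
  tame part 2 on both sides (det unramified at ℓ), Swan = 0 leaves exponents ≤ 2, absorbed by `max 2`. So T5 holds for
  EVERY newform `g` congruent to `f_W` mod `p` — the hypotheses `IsCMForm …` and `¬ p ∣ M` look UNNECESSARY for T5
  (information for LM-D/E/G; not a defect). In print: Livné, J. Number Theory 31 (1989) 133–141 (conductor of `ρ̄`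
  vs `N_f`: wild parts agree, tame defect in `{0,1,2}`), after Carayol 1986/1989. Level-RAISED partners (extra Steinberg prime `q ∤ N_W`, `v_q M = 1`) do
  NOT break it (`max 2 1 = max 2 0`). No kill.
* **T6 `stub_thetaLayerLambda_ns` = Kan₂** (FREE slot). (i) By §2 (`layerLambda_depleted`, `layerLambda_rescale`)
  its conclusion is the Greenberg–Vatsal/ Emerton–Pollack–Weston-type identity `D_an = D_loc` of §4 — numerically
  PASS 21/21 at `p = 5` (paper pre-check), full census = kit j335262. (ii) `S₀ ⊇ bad(W)` is LOAD-BEARING: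
  undepleted λ's differ on 11/21 pre-checked pairs (witness `(26352o1, 5, A : y² = x³ − 4)`: `λ_61(W) = 1`
  (split mult., `61 ≡ 1 (5)`), `λ_61(A) = 2` (good, `a_61(A) ≡ 2 (5)`), `D_an = 1` both parities). (iii)
  `S₀ ⊇ primes(M)` is LOAD-BEARING by the same mechanism on the `g`-side (level-raised ring-class partners).
  (iv) `∀ v ∈ S₀, p ∉ v` is DECORATION AS TYPED (mathematically it is hygiene: `p ∈ Σ₀` has no meaning): were
  `v = (p) ∈ S₀`, `frobeniusExponent p p = 0` (junk on non-units) makes BOTH inserted factors the constant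
  `C (1 + p⁻¹)` (`a_p(W) = 0`; `g`-side `1 − ι(a_p g)·p⁻¹ + p⁻¹`, non-zero by `|a_p(g)| ≤ 2√p < p + 1` even without
  `cuspCoeff g p = 0`), and `λ` is blind to non-zero constants (`layerLambda_C_mul`, `(C c * F) %ₘ ω = C c * (F %ₘ ω)`). (v) the
  orientation `−frobeniusExponent` is immaterial for λ (λ(E(γ)) = λ(E(γ⁻¹))). (vi) `cuspCoeff g p = 0` is
  REDUNDANT: at a good supersingular `p` with `a_p = 0`, `ρ̄_W(I_p)` is the level-2 fundamental character pair, so the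
  projective image contains a cyclic group of order `p + 1 ≥ 4` — it is dihedral `D_n`, `n ≥ 4`, NOT Klein-four — hence
  the inducing field `K` (the index-2 cyclic part) is unique, every CM newform `g` with `ρ̄_g ≅ ρ̄_W` has CM by that
  `K`, `p` is inert in `K`, and `a_p(g) = 0` is automatic (no Klein-four ambiguity; caveat closed in session 4). (vii) the level clause `max 2 …` is redundant modulo T5.
  No kill; hypotheses (ii)–(iii) must stay, (iv) (vi) (vii) are removable as typed. Print analogue (algebraic side): Hatley–Lei, Ann. Inst. Fourier 69 (2019)
  (arXiv:1608.00257) Thm 4.6 — for congruent non-ordinary forms, `μ(Sel_i(f)) = 0 ⇔ μ(Sel_i(g)) = 0` and then the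
  `Σ₀`-imprimitive signed λ's agree (`Σ₀ ⊇` primes of the levels, `p ∉ Σ₀`), local terms by Greenberg–Vatsal —
  the same depletion shape as Kan₂/Kλ₂.
* **T7 `stub_residualThetaMC_ns` = Kλ₂** (HELD by lead). `D.mu = 0` is load-bearing by design (child M supplies it);
  the `G m` rescaling `C (p^m·ϖ)` is λ-inert (§2); `[Module.Finite]`/`IsTorsion` are Kobayashi Thm 1.2 (T1). Its
  analytic input is exactly T6's identity; its algebraic input is Kobayashi's divisibility (T1) + `μ = 0`. No
  independent attack surface beyond T6/T2. No kill.
-/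

/-! ## §4. Numerics (instrument; PREREG-cdisprove-23599-gvkan2.md, sha16 4370d5023df2776b)

Kit job `j335262` (ONE batched job, 4 cores × 5 h asked = the 20 core-h grant, tags bsd/long/bigmem, `--workitem` 23599;
held by the compute gate 19:23–19:29Z; ran 19:29:23Z–21:23:35Z on cmp-10, wall 6841 s, cpu 6794 s ≈ 1.9 core-h, peak RSS
29.6 GB, rc 0, 30 artifacts, verified, auto-attached as evidence on 23599). 130 rows = 93 W (57 partnered @3, 22 partnered @5,
14 unpartnered @5/7/11) + 37 CM partners A. Engines: (B) msengine lit-g7 + iwlayer, byte-identical to j280059, numerical modular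
symbols with integrality certificate (130/130 `symbols_ok`, 0 failed relations, max rounding deviation 8.5e-10), ALL rows;
(E) eclib exact modular symbols on 62 rows (37 partners + 14 unpartnered `p ≥ 5` W + 11 p = 3 W controls), 62/62 ok;
(P) PARI `ellpadiclambdamu` on the 25 partners with `N_A ≤ 8000`. Layers `n ≤ 6/4/3/3` for `p = 3/5/7/11` (Pollack index
`m = n − 1`; «even/odd» = parity of `m`; `n = 1` degenerate, excluded). GV local terms two ways (closed form / direct
T-adic order, both orientations): agree on every term. DECLARED COLLATION BUG: the job's `collate.py` globbed `OUT_E*.jsonl`,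
so `OUT_E_tables.jsonl` shadowed `OUT_E.jsonl` and the as-delivered tables were engine-B-only; fixed by a one-line glob
change (`collate_fix.py` sha16 cd2c82390d36aa03) re-run locally on the job's raw engine outputs (no engine re-run); verdicts,
`D_an`, λ, μ and top layers are identical row by row — the fix only restores the E-engine columns. Tables of record =
recollated: `KAN2.tsv` 5fed9f3207bf7074, `MUONESIGN.tsv` b6f406fadb903af2, `LAYERS.tsv` 09c04126f37ca31c, `SUMMARY.json`
85cfda291421152d, `T1-LAMBDA-BOOKKEEPING.tsv` 185ead7db6a9e935 (all under `pub/bsd-ssimc/cdisprove-stmt-BirchSwinnertonDyer-23599/gvkan2/`).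

CONTROLS (all met): k3-c4 g12 two-engine reference table reproduced 76/76; 301 two-engine (B,E) layers — 186 partner layers +
115 W layers — with 0 disagreements in (μ, λ); THREE engines agree on 25/25 PARI partners (PARI `[[λ_a,λ_b],[μ_a,μ_b]]` =
((λ−q) top even-m, (λ−q) top odd-m; μ's), e.g. `y²=x³−2x @3: (7,1)`, `y²=x³−169x: (1,3)`, `y²=x³−1331 @5: (3,1)`); PREP:
minimal models/conductors 130/130, `a_p(W) = 0` 93/93, `p ∤ N_A` 37/37, congruence `a_ℓ(W) ≡ a_ℓ(A) (mod p)` for `ℓ < 3000`: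
0 mismatches on 79/79.

**Q1 (Kan₂ tightness) = PASS 158/158** (114 @3, 44 @5; FAIL 0, UNDET 0): `D_an := λ_n(ϑ_W) − λ_n(ϑ_A)` at the top common
layer (`p=3`: `n = 5/6`; `p=5`: `n = 3/4`) equals `D_loc := Σ_{ℓ∈S₀}(λ_ℓ(A) − λ_ℓ(W))` in every row and is the same for both
parities of every pair. `D` distribution @3: 0×1, 1×33, 2×11, 3×8, 4×3, 28×1 (456544e1, ℓ = 1297); @5: 0×9, 1×13. Stable at the
previous same-parity layer: @3 109/114 (456544e1 unstable both parities — `D = 28` exceeds the lower layer's headroom; 3 n/a),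
@5 21/44 (even-m has one non-degenerate layer ⇒ 23 n/a). Min headroom 6 (@3), 17 (@5). W-side two engines on 22 rows (controls),
B-only on 136; A-side two engines on all 158. LOAD-BEARING DEPLETION: `D ≠ 0` on 138/158 rows = 69/79 pairs (56/57 @3, 13/22 @5);
EVERY non-zero local contribution is of pattern (W multiplicative at ℓ, A good at ℓ) — 71 terms @3, 13 @5; (additive, additive)
always contributes 0 and no (good, additive) row exists (A additive ⇒ W additive: CM inertia of order 2/4/6 is faithful mod p)
⇒ `S₀ ⊇ bad(W)` (multiplicative part) is numerically load-bearing on 69/79 T1 pairs, `S₀ ⊇ primes(M)` is term-0 ON T1 (it bears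
load only for T2 partners with a level-raising prime `ℓ ∣ M` at which `W` is good, which the max-2 level clause allows).
PREREG reading: located no-counterexample memo — the depleted λ-transport identity Kan₂ types holds on every CM-EC-partnered
small-image pair; its depletion hypothesis cannot be dropped.

**Q2 (`stub_muOneSign_ns_ge5` census) = UNIT-BOTH 93/93** (57 @3, 29 @5, 3 @7, 4 @11): `μ(ϑ_n(W)) = 0` at the top layer of
EACH parity for every W row — for the 36 `p ≥ 5` small-image pairs this includes the 14 never-tabulated ones (207616g1/h1,
249777l1, 269059r1, 301824bp1, 431433g1/o1 @5; 245456b1/c1, 353925ce1 @7; 232544f1/i1, 465088bc1/be1 @11), all 14 with two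
engines agreeing. `(λ−q)(even-m, odd-m)` @5: (0,0)×9, (1,1)×1, (2,2)×15, (2,6)×1, (4,2)×2, (4,6)×1; @7: (2,2)×3; @11: (0,0)×3,
(2,2)×1. Reading: `μ(ϑ_n) = 0` at one layer of the parity attached to a sign forces `μ(L^{sign}) = 0` (`p ∣ L^± ⇒ p ∣ ϑ_n` in the
free `ℤ_p`-module `Λ/ω_n`, division by the distinguished `ω_n` preserving integrality) — modulo the engines' integral
normalisation, i.e. the route's period-unit fact h5 at `p ∤ N`; so every `p ≥ 5` small-image pair of the window carries a
numerical BOTH-signs unit-content certificate at the tabulated layer (usable as a displayed hypothesis; nothing booked). A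
finite table can never certify `μ ≥ 1`: no kill letter for Q2 exists under any outcome, and none was needed.

WHAT THE TABLES GIVE THE LINE (information for the LEAD's T1/R3 option; not a proof of any stub; T2 = 57 pairs untouched):
per T1 pair and sign, `T1-LAMBDA-BOOKKEEPING.tsv` lists `(n_top, q_n, λ_n(ϑ_W), λ_n(ϑ_A), D_an, D_loc + local terms, μ's,
engines)`. Read through PRINT theorems — Kim 2009 Cor 2.13 (λ-transfer for congruent `a_p = 0` curves given `μ^± = 0`; tree
`BDKim2009.cor213_…`), Pollack–Rubin 2004 (`λ(X^±_A) = λ(L^±_A)`, `μ = 0`; tree `PollackRubin2004.…_of_cm`), Greenberg–Vatsal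
Prop 2.4 / Kim Prop 2.6 (`δ^alg_ℓ = δ^an_ℓ`), Pollack 2003 (`λ(ϑ_n) = λ(L^∓) + q_n` inside the headroom) — each row says
`λ(X^ε_W) = (λ−q)_A + D_loc = (λ−q)_W = λ(L^ε_W)` and `μ(X^ε_W) = μ(L^ε_W) = 0`, both signs, all 79 T1 pairs: with Kato's
RATIONAL divisibility (h41) that is the signed main conjecture for those 79 curves as a NUMERICAL RECORD SHAPE (the same 79
as crux 4's k3-c4 records, there via the PRE transfer binder hCL; here via PRINT λ-transfer + a displayed λ-identity).

Paper PRE-CHECK (pure point counts vs the certified k3-c4 g12 two-engine λ-table, `p = 5`, layers `m = 1` odd /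
`m = 2` even; `λ_ℓ = p^{v_p(f_ℓ)}·mult_{y=1}(y² − a_ℓ y + ℓ mod p)` good, `p^{v}·[ℓ ≡ a_ℓ (p)]` multiplicative, `0`
additive): `D_loc = D_an` on 21/21 pairs, both parities —
`26352o1/cm0m4: 1=1 · 101952bs1/cm0m32: 0=0 · 105408l1/cm0p32: 0=0 · 105408z1/cm0m32: 0=0 · 126324c1/cm0m1331: 1=1 ·
197748b1/cm0p4: 0=0 · 204624dp1/cm0p343: 1=1 (even; odd UNDET in g12) · 322812m1/cm0m1372: 0=0 · 363312bl1/cm0m97556: 0=0 ·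
376884m1/cm0m6859: 1=1 · 401868k1/cm0p907924: 0=0 · 416448ba1,bd1/cm0m2: 1=1 · 416448by1,cb1/cm0p2: 1=1 ·
421596m1/cm0p9604: 0=0 · 421596v1/cm0m28: 1=1 · 470988j1/cm0p196: 1=1 · 470988o1/cm0m67228: 1=1 · 475983d1/cm72a3: 1=1 ·
484416do1/cm0m195112: 0=0`. Undepleted λ's differ on the 11 rows with `D = 1` ⇒ `S₀ ⊇ bad(W)` is load-bearing.
-/

/-! ## §5. HANDOFF (gen 0, after session 4 — 2026-08-29T21:5xZ)
* Landed on the Negative lane: p741144 ACCEPTED (commit 9f2a0492bf5d)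
  `Theorems/SmallImageLowerHalfBothSigns/Negative/LayerProductRuleHeadroomLoadBearing.lean` — the layer product rule with
  its headroom hypothesis deleted is FALSE (ℚ₂, `ω₁ = X²+2X`, `θ = P = X`: `λ((X·X) %ₘ ω₁) = 1 ≠ 2`) ⇒ Kan₂/Kλ₂'s `∃ n₀`
  clause is not decoration. No other negative lemma has a constructible `H` (the false weakenings found — undepleted Kan₂ —
  are NUMERICAL, witnessed by actual θ-elements, not kernel-expressible today).
* Sorried here: nothing.
* Kit: j335262 DONE (§4); 1.9 of the 20 granted core-h used; no second job needed (no FAIL/UNDET row to re-derive).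
* Deposits: `pub/bsd-ssimc/cdisprove-stmt-BirchSwinnertonDyer-23599/{HANDOFF.md, Disproof.lean, PREREG…, PRECHECK-kan2-p5.tsv,
  smallimage_pairs.tsv, T1-CENSUS.md, Negative/, gvkan2/…}` (sha16s on STATUS).
* Next regimes for the next generation: (1) the LEAD's reshape (v3: one-sided Kλ₂^≥; R2 split into (M2) λ-transfer fact /
  (M3^≥) partner lower bound / (M4) depleted-layer bookkeeping) — attack each new stub text on registration: (M4) is
  benchable against `T1-LAMBDA-BOOKKEEPING.tsv` row by row, (M2) against Hatley–Lei 2019 Thm 4.6's exact hypothesis list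
  ((irred)/(inv)/(tor)/(Cong), `p ∉ Σ₀`), (M3^≥) has no model attack (conjecture-grade on T2); (2) lead's STUCK stubs when a
  HANDOFF names them; (3) if a T2 partner list is ever produced (CM newforms with non-rational coefficients), extend Q1 to it
  (the only regime where `S₀ ⊇ primes(M)` bears load).
-/

end Summit.BirchSwinnertonDyer.BirchSwinnertonDyer.Cruxes.SmallImageLowerHalfBothSigns.Disproof
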